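import Summits.RiemannHypothesis.RiemannHypothesis.Theorems.MotivicDoorFunctionFieldParity
import Literature.AlgebraicGeometry.Motives.AbelianVarietyHondaTatePrime

/-!
# The function-field door, part 10: the PRIME-FIELD door — exponent ONE for honest data over `𝔽_p`

FF-DOOR statement (ii) in the form chartered, "GEOMETRIC ORIGIN ⟺ RH for honest Weil polynomials",
WITHOUT "up to a power", over a PRIME field.  HONEST FRAMING (verbatim, binding): lottery ticket at the
motivic door; RH probability negligible; consolation prizes are real: a new semi-local Weil-positivity
theorem, or a located gap in the Connes–Consani programme, plus the ff-door theorem.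

Named facts used (explicit hypotheses, never asserted): `(W)` `weilRiemannHypothesis` and the NEW
`(HTP)` `AbelianVariety.hondaTatePrimeField K` — van Bommel–Costa–Li–Poonen–Smith 2021
(arXiv:2106.13651, § 2 p. 5; held, read), Theorem 2.1 with Remark 2.3, "restatements of results in
[Waterhouse 1969]": for `q` PRIME, every `f ∈ ℤ[x]` monic of degree `2n`, `q`-symmetric
(`f^{[i]} = q^{n-i} f^{[2n-i]}`) with all complex roots of absolute value `q^{1/2}` is the characteristic
polynomial of an abelian variety of dimension `n` over `𝔽_q` ("If `q` is prime, then (d') holds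
automatically").  Where stated, `(P0)` is the explicit inline hypothesis of part 9 (`P_A(0) > 0`).

* [PROVED, fact-free] our functional equation `q^g c_j = q^i c_i` (`i + j = 2g`) implies vBCLPS's
  `q`-symmetry (`qSymm_of_fe`); an honest RH-true datum is an `IsSymmetricWeilPoly` (`isSymmetricWeilPoly_of_fe_of_rh`);
  RH passes to powers (`rh_pow`).
* [PROVED from (HTP)] `geometric_of_rh_prime`: over `#K = p` prime, an honest RH-true `h` of degree
  `2g ≥ 2` is `P_A` for an `A` of dimension `g` — exponent ONE.
* **THE PRIME-FIELD DOOR** [PROVED from (W) + (HTP)] `primeDoor_abelianVariety`: for honest `(p, h)` of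
  dimension `g ≥ 1` over the prime field, `RH(p, h) ⟺ ∃ A/𝔽_p, P_A = h`; window form
  `primeDoor_windows`: `(∀ M, T_M(p, h) ⪰ 0) ⟺ ∃ A, P_A = h`.
* **THE EXPONENT SET OVER `𝔽_p`** [PROVED]: for an RH-true monic `h` of degree `2g ≥ 2` (so
  `h(0) = ± p^g`, part 7): if `h(0) = p^g`, EVERY `E ≥ 1` is admissible (`forall_pow_geometric_of_fe_prime`,
  (HTP)); if `h(0) = -p^g`, every EVEN `E ≥ 2` is admissible (`even_pow_geometric_of_rh_prime`, (HTP): `h²`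
  is honest) and, under `(P0)`, ONLY those (`geometric_pow_iff_even_of_coeff_zero_eq_neg_prime`).  Instance:
  `(p, x² - p)` has admissible exponents exactly the even ones (`geometric_pow_X_sq_sub_C_iff_even_prime`).
* [DATA, not used] over prime powers `q = p^a`, `a ≥ 2`, exponent one fails for some honest data (the
  period-`2` Weil `49`-number of part 4, LMFDB `2.49.a_fq`), so the hypothesis "`q` prime" is sharp here.
-/

open Polynomial
open scoped ComplexOrder
open Summit.RiemannHypothesis.RiemannHypothesis.Theorems.PfPersistence.FfAngleTwin
open Literature.AlgebraicGeometry.Motives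

namespace Summit.RiemannHypothesis.RiemannHypothesis.Theorems.MotivicDoor.FunctionField

set_option linter.dupNamespace false

universe u

/-! ## Dictionary: our functional equation versus `q`-symmetry (fact-free) -/

/-- The honest functional equation `q^g c_j = q^i c_i` (`i + j = 2g`) implies `q`-symmetry in the sense
of van Bommel–Costa–Li–Poonen–Smith: `c_i = q^{g-i} c_{2g-i}` for `i < g` (cancel `q^g`). [PROVED] -/
theorem qSymm_of_fe {q : ℕ} (hq : 0 < q) {h : ℤ[X]} {g : ℕ}
    (hFE : ∀ i j, i + j = 2 * g → (q : ℤ) ^ g * h.coeff j = (q : ℤ) ^ i * h.coeff i) :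
    ∀ i, i < g → h.coeff i = (q : ℤ) ^ (g - i) * h.coeff (2 * g - i) := by
  intro i hi
  have h1 := hFE (2 * g - i) i (by omega)
  have hqg : (q : ℤ) ^ g ≠ 0 := pow_ne_zero _ (by exact_mod_cast hq.ne')
  have hsplit : (q : ℤ) ^ (2 * g - i) = (q : ℤ) ^ g * (q : ℤ) ^ (g - i) := by
    rw [← pow_add]; congr 1; omega
  rw [hsplit, mul_assoc] at h1
  exact mul_left_cancel₀ hqg h1

/-- RH passes to powers: the roots of `h ^ E` are those of `h`. [PROVED] -/
theorem rh_pow {q : ℕ} {h : ℤ[X]} (hRH : ∀ α ∈ frobRoots h, ‖α‖ = Real.sqrt q) (E : ℕ) :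
    ∀ α ∈ frobRoots (h ^ E), ‖α‖ = Real.sqrt q := by
  intro α hα
  unfold frobRoots at hα
  rw [Polynomial.map_pow, Polynomial.roots_pow, Multiset.mem_nsmul] at hα
  exact hRH α hα.2

/-- An honest RH-true datum of dimension `g` satisfies vBCLPS (a), (b), (c) for `(q, g)`. [PROVED] -/
theorem isSymmetricWeilPoly_of_fe_of_rh {q : ℕ} (hq : 0 < q) {h : ℤ[X]} {g : ℕ} (hh : h.Monic)
    (hdeg : h.natDegree = 2 * g)
    (hFE : ∀ i j, i + j = 2 * g → (q : ℤ) ^ g * h.coeff j = (q : ℤ) ^ i * h.coeff i)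
    (hRH : ∀ α ∈ frobRoots h, ‖α‖ = Real.sqrt q) : IsSymmetricWeilPoly q g h :=
  ⟨⟨hh, hdeg⟩, qSymm_of_fe hq hFE, hRH⟩

/-! ## The prime-field door -/

variable {K : Type u} [Field K] [Finite K]

/-- Over a PRIME field, an honest RH-true datum of dimension `g ≥ 1` is the characteristic polynomial of
an abelian variety of dimension `g` — exponent ONE. [PROVED from (HTP)] -/
theorem geometric_of_rh_prime (hHTP : AbelianVariety.hondaTatePrimeField K) (hp : (Nat.card K).Prime)
    {h : ℤ[X]} {g : ℕ} (hg : 0 < g) (hh : h.Monic) (hdeg : h.natDegree = 2 * g)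
    (hFE : ∀ i j, i + j = 2 * g → (Nat.card K : ℤ) ^ g * h.coeff j = (Nat.card K : ℤ) ^ i * h.coeff i)
    (hRH : ∀ α ∈ frobRoots h, ‖α‖ = Real.sqrt (Nat.card K)) :
    ∃ A : AbelianVariety K, A.dim = g ∧ A.IsFrobCharpoly h :=
  hHTP hp g h hg (isSymmetricWeilPoly_of_fe_of_rh Nat.card_pos hh hdeg hFE hRH)

/-- **THE PRIME-FIELD DOOR.**  Over `K` with `#K = p` prime, for every honest datum `(p, h)` of dimension
`g ≥ 1`: `RH(p, h) ⟺ ∃ A/K, P_A = h` — statement (ii) with exponent ONE.  `⇐` is `(W)`, `⇒` is `(HTP)`.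
[PROVED from hW and hHTP] -/
theorem primeDoor_abelianVariety (hW : ∀ A : AbelianVariety K, A.weilRiemannHypothesis)
    (hHTP : AbelianVariety.hondaTatePrimeField K) (hp : (Nat.card K).Prime)
    {h : ℤ[X]} {g : ℕ} (hg : 0 < g) (hh : h.Monic) (hdeg : h.natDegree = 2 * g)
    (hFE : ∀ i j, i + j = 2 * g → (Nat.card K : ℤ) ^ g * h.coeff j = (Nat.card K : ℤ) ^ i * h.coeff i) :
    (∀ α ∈ frobRoots h, ‖α‖ = Real.sqrt (Nat.card K)) ↔ ∃ A : AbelianVariety K, A.IsFrobCharpoly h := by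
  refine ⟨fun hRH => ?_, fun ⟨A, hA⟩ => rh_of_geometric_pow hW one_pos (C := A) (by rwa [pow_one])⟩
  obtain ⟨A, -, hA⟩ := geometric_of_rh_prime hHTP hp hg hh hdeg hFE hRH
  exact ⟨A, hA⟩

/-- **The prime-field door, window form.**  For honest `(p, h)` of dimension `g ≥ 1` over the prime field:
all windows `T_M(p, h) ⪰ 0` `⟺` `h` itself is a `P_A`. [PROVED from hW and hHTP] -/
theorem primeDoor_windows (hW : ∀ A : AbelianVariety K, A.weilRiemannHypothesis)
    (hHTP : AbelianVariety.hondaTatePrimeField K) (hp : (Nat.card K).Prime)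
    {h : ℤ[X]} {g : ℕ} (hg : 0 < g) (hh : h.Monic) (hdeg : h.natDegree = 2 * g)
    (hFE : ∀ i j, i + j = 2 * g → (Nat.card K : ℤ) ^ g * h.coeff j = (Nat.card K : ℤ) ^ i * h.coeff i) :
    (∀ M, (weilWindowForm (Nat.card K : ℝ) h M).PosSemidef) ↔ ∃ A : AbelianVariety K, A.IsFrobCharpoly h := by
  rw [← primeDoor_abelianVariety hW hHTP hp hg hh hdeg hFE,
    rh_iff_twistedFE_and_windows (Nat.card_pos (α := K)) hh]
  exact ⟨fun hM => ⟨twistedFE_of_fe Nat.card_pos hh hdeg hFE, hM⟩, fun h2 => h2.2⟩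

/-! ## The exponent set over a prime field -/

/-- Over a prime field an HONEST RH-true datum has EVERY exponent `E ≥ 1` admissible (`h = P_A`, then
`h ^ E = P_{A^E}`). [PROVED from hHTP] -/
theorem forall_pow_geometric_of_fe_prime (hHTP : AbelianVariety.hondaTatePrimeField K)
    (hp : (Nat.card K).Prime) {h : ℤ[X]} {g : ℕ} (hg : 0 < g) (hh : h.Monic) (hdeg : h.natDegree = 2 * g)
    (hFE : ∀ i j, i + j = 2 * g → (Nat.card K : ℤ) ^ g * h.coeff j = (Nat.card K : ℤ) ^ i * h.coeff i)
    (hRH : ∀ α ∈ frobRoots h, ‖α‖ = Real.sqrt (Nat.card K)) {E : ℕ} (hE : 0 < E) :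
    ∃ C : AbelianVariety K, C.IsFrobCharpoly (h ^ E) := by
  obtain ⟨A, -, hA⟩ := geometric_of_rh_prime hHTP hp hg hh hdeg hFE hRH
  exact AbelianVariety.exists_isFrobCharpoly_pow hA hE

/-- Over a prime field an RH-true datum of degree `2g ≥ 2` has every EVEN exponent `E ≥ 2` admissible:
`h²` is honest (`h(0)² = p^{2g}`), so `h² = P_A` by `(HTP)`, and `h^{2k} = P_{A^k}`.  No sign hypothesis.
[PROVED from hHTP] -/
theorem even_pow_geometric_of_rh_prime (hHTP : AbelianVariety.hondaTatePrimeField K)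
    (hp : (Nat.card K).Prime) {h : ℤ[X]} {g : ℕ} (hg : 0 < g) (hh : h.Monic) (hdeg : h.natDegree = 2 * g)
    (hRH : ∀ α ∈ frobRoots h, ‖α‖ = Real.sqrt (Nat.card K)) {E : ℕ} (hE : 0 < E) (hEven : Even E) :
    ∃ C : AbelianVariety K, C.IsFrobCharpoly (h ^ E) := by
  obtain ⟨k, rfl⟩ := hEven
  have hk : 0 < k := by omega
  have hh2 : (h ^ 2).Monic := hh.pow 2
  have hdeg2 : (h ^ 2).natDegree = 2 * (2 * g) := by rw [hh.natDegree_pow, hdeg]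
  have hRH2 := rh_pow hRH 2
  have hc0 : (h ^ 2).coeff 0 = (Nat.card K : ℤ) ^ (2 * g) := by
    rw [coeff_zero_pow_eq, coeff_zero_sq_eq_of_rh Nat.card_pos hh hdeg hRH, ← pow_mul, mul_comm]
  have hFE2 := (fe_iff_coeff_zero_of_rh Nat.card_pos hh2 hdeg2 hRH2).2 hc0
  obtain ⟨A, -, hA⟩ := geometric_of_rh_prime hHTP hp (by omega) hh2 hdeg2 hFE2 hRH2
  obtain ⟨C, hC⟩ := AbelianVariety.exists_isFrobCharpoly_pow hA hk
  exact ⟨C, by rwa [← two_mul, pow_mul]⟩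

/-- **The exponent set over a prime field, wrong sign.**  Under `(HTP)` and the explicit hypothesis
`(P0)`: an RH-true datum of degree `2g ≥ 2` with `h(0) = -p^g` has admissible exponents EXACTLY the
even ones. [PROVED from hHTP and the explicit hypothesis (P0)] -/
theorem geometric_pow_iff_even_of_coeff_zero_eq_neg_prime (hHTP : AbelianVariety.hondaTatePrimeField K)
    (hP0 : ∀ (A : AbelianVariety K) (P : ℤ[X]), 0 < A.dim → A.IsFrobCharpoly P → 0 < P.coeff 0)
    (hp : (Nat.card K).Prime) {h : ℤ[X]} {g : ℕ} (hg : 0 < g) (hh : h.Monic) (hdeg : h.natDegree = 2 * g)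
    (hRH : ∀ α ∈ frobRoots h, ‖α‖ = Real.sqrt (Nat.card K)) (hneg : h.coeff 0 = -((Nat.card K : ℤ) ^ g))
    {E : ℕ} (hE : 0 < E) :
    (∃ C : AbelianVariety K, C.IsFrobCharpoly (h ^ E)) ↔ Even E := by
  refine ⟨fun ⟨C, hC⟩ => ?_, even_pow_geometric_of_rh_prime hHTP hp hg hh hdeg hRH hE⟩
  have hqpos : (0 : ℤ) < (Nat.card K : ℤ) ^ g := pow_pos (by exact_mod_cast (Nat.card_pos (α := K))) _
  exact even_of_geometric_pow_of_coeff_zero_neg hP0 hh (by omega) (by rw [hneg]; linarith) hE hC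

/-- **The exponent set over a prime field, dichotomy.**  Under `(HTP)` + `(P0)`, for an RH-true monic `h`
of degree `2g ≥ 2` over `#K = p` prime and `E ≥ 1`: `h ^ E` is a `P_C` iff (`h(0) = p^g`) or
(`h(0) = -p^g` and `E` even) — and `h(0) = ± p^g` always holds (part 7). [PROVED from hHTP, (P0)] -/
theorem geometric_pow_iff_prime (hHTP : AbelianVariety.hondaTatePrimeField K)
    (hP0 : ∀ (A : AbelianVariety K) (P : ℤ[X]), 0 < A.dim → A.IsFrobCharpoly P → 0 < P.coeff 0)
    (hp : (Nat.card K).Prime) {h : ℤ[X]} {g : ℕ} (hg : 0 < g) (hh : h.Monic) (hdeg : h.natDegree = 2 * g)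
    (hRH : ∀ α ∈ frobRoots h, ‖α‖ = Real.sqrt (Nat.card K)) {E : ℕ} (hE : 0 < E) :
    (∃ C : AbelianVariety K, C.IsFrobCharpoly (h ^ E)) ↔
      h.coeff 0 = (Nat.card K : ℤ) ^ g ∨ (h.coeff 0 = -((Nat.card K : ℤ) ^ g) ∧ Even E) := by
  rcases coeff_zero_eq_or_eq_neg_of_rh Nat.card_pos hh hdeg hRH with hpos | hneg
  · have hFE := (fe_iff_coeff_zero_of_rh Nat.card_pos hh hdeg hRH).2 hpos
    exact ⟨fun _ => Or.inl hpos, fun _ => forall_pow_geometric_of_fe_prime hHTP hp hg hh hdeg hFE hRH hE⟩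
  · rw [geometric_pow_iff_even_of_coeff_zero_eq_neg_prime hHTP hP0 hp hg hh hdeg hRH hneg hE]
    have hqpos : (0 : ℤ) < (Nat.card K : ℤ) ^ g := pow_pos (by exact_mod_cast (Nat.card_pos (α := K))) _
    constructor
    · exact fun hEv => Or.inr ⟨hneg, hEv⟩
    · rintro (hpos | ⟨-, hEv⟩)
      · exfalso; rw [hneg] at hpos; linarith
      · exact hEv

/-- Instance: over `#K = p` prime, `(x² - p) ^ E` is a `P_C` iff `E` is even (`(HTP)`; the "only if"
under `(P0)`). [PROVED from hHTP, (P0)] -/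
theorem geometric_pow_X_sq_sub_C_iff_even_prime (hHTP : AbelianVariety.hondaTatePrimeField K)
    (hP0 : ∀ (A : AbelianVariety K) (P : ℤ[X]), 0 < A.dim → A.IsFrobCharpoly P → 0 < P.coeff 0)
    (hp : (Nat.card K).Prime) {E : ℕ} (hE : 0 < E) :
    (∃ C : AbelianVariety K, C.IsFrobCharpoly ((X ^ 2 - Polynomial.C (Nat.card K : ℤ)) ^ E)) ↔ Even E := by
  obtain ⟨hm, hdeg, hc0, -⟩ := X_sq_sub_C_shape (Nat.card K : ℤ)
  exact geometric_pow_iff_even_of_coeff_zero_eq_neg_prime hHTP hP0 hp one_pos hm (hdeg.trans (by norm_num))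
    (frobRoots_norm_eq_of_X_sq_sub_C (Nat.card K)) (by rw [hc0, pow_one]) hE

/-- Instance, existence half only (no `(P0)`): over `#K = p` prime, `(x² - p)²` is a `P_A`.
[PROVED from hHTP] -/
theorem geometric_X_sq_sub_C_sq_prime (hHTP : AbelianVariety.hondaTatePrimeField K)
    (hp : (Nat.card K).Prime) :
    ∃ C : AbelianVariety K, C.IsFrobCharpoly ((X ^ 2 - Polynomial.C (Nat.card K : ℤ)) ^ 2) := by
  obtain ⟨hm, hdeg, -, -⟩ := X_sq_sub_C_shape (Nat.card K : ℤ)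
  exact even_pow_geometric_of_rh_prime hHTP hp one_pos hm (hdeg.trans (by norm_num))
    (frobRoots_norm_eq_of_X_sq_sub_C (Nat.card K)) two_pos even_two

end Summit.RiemannHypothesis.RiemannHypothesis.Theorems.MotivicDoor.FunctionField
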